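import Literature.AlgebraicGeometry.Frobenioids.PadicKummerSetting
import Literature.NumberTheory.GaloisRepresentations.GaloisSubgroups
import HarnessLib

/-!
# Frobenioids II, Definition 2.2 (i): the context of one object, instantiated at the Galois level

Mochizuki, *The geometry of Frobenioids II*, Kyushu J. Math. **62** (2008) 401–460, §2 "The Kummer
and Reciprocity Maps", setting p. 17 and Definition 2.2 (i)–(ii) pp. 17–18
[cite: MochizukiFrdII2008, Def 2.2 (i) p.17]. Companion to `PadicKummerSetting.lean`
(abc-iut-L1-t7), ADDITIVE: no statement of that file is changed.

**What the paper fixes (p. 17).** `G := Im(Π) ⊆ Q ≅ G_{ℚ_p}` is the absolute Galois group of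
"`K`, the finite extension of `ℚ_p` determined by the open subgroup `G ⊆ Q`";
`E := B^temp(G, G°)⁰`, so that a connected Galois object `A_E` of `E` "is" `Spec L` for a finite
Galois extension `L/K` inside `K̄` (Remark 2.2.1: "Write `A_E = Spec(L)` [so `L` is a finite
extension of `K`]"), `Aut_E(A_E) = Gal(L/K)`, and "the natural surjective outer homomorphism
`G ↠ Aut_E(A_E)`" is the restriction `G_K ↠ Gal(L/K)` with kernel `G_L = Gal(K̄/L)`; `H ⊆ G` is
"a normal open subgroup" and `H_A := Im(H) ⊆ G_A`.

**What this file does.** `PadicKummerSetting.Def22Context` records these objects as an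
INTERFACE (fields `G`, `H`, `AutE`, `outer`, …), over which Def. 2.2 (ii)(iii), Def. 2.3,
Theorem 2.4 and Remarks 2.2.1/2.4.1/2.4.2 are typed as SCHEMAS ("closed instantiation: the
`p`-adic Frobenioid of Ex. 1.1 + the LCFT pin", per their docstrings). Here the GALOIS HALF of
that instantiation is constructed over the tree's absolute-Galois-group library
(`Literature.NumberTheory.GaloisRepresentations`: `Field.absoluteGaloisGroup K` with the Krull
topology, `resGal L : Γ_K ↠ Gal(L/K)`, `galFixing K L = Gal(K̄/L)`):
* `Def22Context.ofGalois` — `G := Γ_K`, `H` the given open normal subgroup,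
  `Aut_E(A_E) := L ≃ₐ[K] L`, `outer := resGal L` (surjective, kernel `Gal(K̄/L)` open — PROVED
  from the tree), "`A_D` is Galois" `:= IsGalois K L`; the monoid `O^□(A)` with its
  `Gal(L/K)`-action and the homomorphism `Aut_C(A) → Gal(L/K)` through which `Aut_C(A)` acts
  (Def. 2.2 (i), first sentence; [FrdII] Thm. 1.2 (ii) for the `p`-adic Frobenioid) remain
  PARAMETERS — they are the Frobenioid half (abc-iut-L1-t4's `PadicFrd.Datum`, Ex. 1.1 (ii),
  and `O^×(A) ≅ O_{K_A}^×`, abc-iut-L1-d10), plugged in by `res`/`res_smul`;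
* the identifications Def. 2.2 (i) asserts, now as lemmas: `H_A = Im(H ↠ Gal(L/K))`
  (`HA_ofGalois`), `Ker(H ↠ H_A) = H ∩ Gal(K̄/L)` (`mem_ker_toHA_ofGalois_iff`), and the fixed
  field `L^{H_A}` of Remark 2.2.1 pinned by the Galois correspondence
  (`galFixing_fixedField_HA`: `Gal(K̄/L^{H_A}) = H · Gal(K̄/L)`).
Nothing is asserted about [IUTchIII]; this is classical Galois theory of a field `K` (any field;
the `p`-adic hypotheses enter only with the LCFT facts). Universe `0` throughout, as in
`KummerClass.lean` / `PadicKummerSetting.lean` (Mathlib's cocycle API lives in `Type`).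
-/

namespace Literature.AlgebraicGeometry.Frobenioids

namespace PadicKummer

open Field IntermediateField
open Literature.NumberTheory.GaloisRepresentations
open Literature.NumberTheory.GaloisRepresentations.LocalWeilDatum

namespace Def22Context

variable {K : Type} [Field K] (L : IntermediateField K (AlgebraicClosure K)) [Normal K L]
  [FiniteDimensional K L]
  (H : Subgroup (absoluteGaloisGroup K)) [H.Normal] (hH : IsOpen (H : Set (absoluteGaloisGroup K)))
  {AutC O : Type} [Group AutC] [CommMonoid O] [IsCancelMul O] [MulDistribMulAction AutC O]
  [MulDistribMulAction (L ≃ₐ[K] L) O] (res : AutC →* (L ≃ₐ[K] L))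
  (res_smul : ∀ (α : AutC) (x : O), res α • x = α • x)

/-- **Definition 2.2 (i), instantiated at the Galois level** (FrdII p. 17): the context of one
object `A` with `A_E = Spec L`, `L ⊆ K̄` a finite normal extension of `K` (reducible, so that
the instances on `Gal(L/K)`, `G_K`, `O` are seen through the projections): `G := G_K = Gal(K̄/K)`
("`G := Im(Π) ⊆ Q ≅ G_{ℚ_p}`", identified with the absolute Galois group of "the finite extension
`K` of `ℚ_p` determined by `G`"), `H ⊆ G` the given normal open subgroup,
`Aut_E(A_E) := Gal(L/K)`, "the natural surjective outer homomorphism `G ↠ Aut_E(A_E)`" `:=` the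
restriction `resGal L : G_K → Gal(L/K)` (a representative), "`A_D` is Galois" `:= IsGalois K L`.
The monoid `O = O^□(A)` with the descended action of `Gal(L/K)` and `res : Aut_C(A) → Gal(L/K)`
(through which "the natural action by conjugation of `Aut_C(A)`" factors) are parameters.
[cite: MochizukiFrdII2008, Def 2.2 (i) p.17] -/
noncomputable abbrev ofGalois : Def22Context where
  AutC := AutC
  O := O
  AutE := L ≃ₐ[K] L
  res := res
  res_smul := res_smul
  G := absoluteGaloisGroup K
  H := H
  isOpen_H := hH
  isGalois := IsGalois K L
  outer := resGal L
  outer_surjective := fun _ => resGal_surjective L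
  isOpen_ker_outer := by
    rw [ker_resGal]
    exact isOpen_galFixing K L

/-! ### Unfolding lemmas (all `rfl`) -/

/-- `G = G_K`. [cite: MochizukiFrdII2008, Def 2.2 (i) p.17] -/
theorem G_ofGalois : (ofGalois L H hH res res_smul).G = absoluteGaloisGroup K := rfl

/-- `H` is the given open normal subgroup. [cite: MochizukiFrdII2008, Def 2.2 (i) p.17] -/
theorem H_ofGalois : (ofGalois L H hH res res_smul).H = H := rfl

/-- `Aut_E(A_E) = Gal(L/K)`. [cite: MochizukiFrdII2008, Def 2.2 (i) p.17] -/
theorem AutE_ofGalois : (ofGalois L H hH res res_smul).AutE = (L ≃ₐ[K] L) := rfl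

/-- `O^□(A)` is the given monoid. [cite: MochizukiFrdII2008, Def 2.2 (i) p.17] -/
theorem O_ofGalois : (ofGalois L H hH res res_smul).O = O := rfl

/-- The representative of `G ↠ Aut_E(A_E)` is the restriction `G_K → Gal(L/K)`.
[cite: MochizukiFrdII2008, Def 2.2 (i) p.17] -/
theorem outer_ofGalois : (ofGalois L H hH res res_smul).outer = resGal L := rfl

/-- "`A_D` is Galois" reads `IsGalois K L`. [cite: MochizukiFrdII2008, Def 2.2 (ii)(b) p.17] -/
theorem isGalois_ofGalois : (ofGalois L H hH res res_smul).isGalois = IsGalois K L := rfl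

/-! ### Definition 2.2 (i): the identifications -/

/-- `Ker(G ↠ Aut_E(A_E)) = Gal(K̄/L)` (the open subgroup classifying `A_E = Spec L`).
[cite: MochizukiFrdII2008, Def 2.2 (i) p.17] -/
theorem ker_outer_ofGalois : (ofGalois L H hH res res_smul).outer.ker = galFixing K L :=
  ker_resGal L

/-- `H_A := Im(H)` is the image of `H` under `G_K ↠ Gal(L/K)`.
[cite: MochizukiFrdII2008, Def 2.2 (i) p.17] -/
theorem HA_ofGalois : (ofGalois L H hH res res_smul).HA = H.map (resGal L) := rfl

/-- Membership in `H_A`: `τ ∈ H_A ↔ τ = σ|_L` for some `σ ∈ H`.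
[cite: MochizukiFrdII2008, Def 2.2 (i) p.17] -/
theorem mem_HA_ofGalois_iff (τ : L ≃ₐ[K] L) :
    τ ∈ (ofGalois L H hH res res_smul).HA ↔ ∃ σ ∈ H, resGal L σ = τ := Subgroup.mem_map

/-- `H ↠ H_A` is `σ ↦ σ|_L`. [cite: MochizukiFrdII2008, Def 2.2 (i) p.17] -/
theorem coe_toHA_ofGalois (σ : H) :
    (((ofGalois L H hH res res_smul).toHA σ : (ofGalois L H hH res res_smul).HA) : L ≃ₐ[K] L) =
      resGal L σ := rfl

/-- `Ker(H ↠ H_A) = H ∩ Gal(K̄/L)`: `σ ∈ H` maps to `1 ∈ H_A` iff `σ` fixes `L` pointwise.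
[cite: MochizukiFrdII2008, Def 2.2 (i) p.17] -/
theorem mem_ker_toHA_ofGalois_iff (σ : H) :
    σ ∈ (ofGalois L H hH res res_smul).toHA.ker ↔ (σ : absoluteGaloisGroup K) ∈ galFixing K L := by
  rw [← ker_resGal L, MonoidHom.mem_ker, MonoidHom.mem_ker, Subtype.ext_iff]
  exact Iff.rfl

/-- `Ker(H ↠ H_A)`, as a subgroup of `H`, is `(H ∩ Gal(K̄/L))` viewed in `H`.
[cite: MochizukiFrdII2008, Def 2.2 (i) p.17] -/
theorem ker_toHA_ofGalois :
    (ofGalois L H hH res res_smul).toHA.ker = (galFixing K L).subgroupOf H :=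
  Subgroup.ext fun σ => (mem_ker_toHA_ofGalois_iff L H hH res res_smul σ).trans Subgroup.mem_subgroupOf.symm

/-- The preimage of `H_A` under `G_K ↠ Gal(L/K)` is `H · Gal(K̄/L)`.
[cite: MochizukiFrdII2008, Def 2.2 (i) p.17] -/
theorem comap_HA_ofGalois :
    (ofGalois L H hH res res_smul).HA.comap (resGal L) = H ⊔ galFixing K L := by
  rw [HA_ofGalois, Subgroup.comap_map_eq, ker_resGal]

section Galois

variable [IsGalois K L]

/-- **Remark 2.2.1, the field `L^H`** (FrdII p. 18: "[where the superscript `H`'s denote the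
submonoids/subfields of elements on which `H_A` acts trivially]"): under the Galois correspondence
for `K̄/K`, the fixed field `L^{H_A} ⊆ L` of `H_A` has absolute Galois group
`Gal(K̄/L^{H_A}) = H · Gal(K̄/L)` — i.e. `L^{H_A} = L ∩ K̄^H`.
[cite: MochizukiFrdII2008, Rmk 2.2.1 p.18] -/
theorem galFixing_fixedField_HA :
    galFixing K (lift (fixedField (ofGalois L H hH res res_smul).HA)) = H ⊔ galFixing K L := by
  rw [galFixing_lift_fixedField, comap_HA_ofGalois]

/-- `H ≤ Gal(K̄/L^{H_A})`: every element of `H` fixes `L^{H_A}` pointwise (so `H_A`-invariants of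
`O^□(A)` are exactly the `H`-invariants for the action through `H ↠ H_A`).
[cite: MochizukiFrdII2008, Rmk 2.2.1 p.18] -/
theorem le_galFixing_fixedField_HA :
    H ≤ galFixing K (lift (fixedField (ofGalois L H hH res res_smul).HA)) := by
  rw [galFixing_fixedField_HA]
  exact le_sup_left

end Galois

/-! ### Definition 2.2 (ii): consequences for the Galois context -/

/-- **Definition 2.2 (ii)(b)** for the Galois context: an `(N, H)`-saturated `A` has `L/K`
Galois. [cite: MochizukiFrdII2008, Def 2.2 (ii) p.17] -/
theorem isGalois_of_isNHSaturated {N : ℕ} (h : IsNHSaturated (ofGalois L H hH res res_smul) N) :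
    IsGalois K L := h.galois

/-- The invariants `O^□(A)^H` (FrdII p. 18) for the Galois context: `f` is `H_A`-invariant iff
`σ|_L • f = f` for all `σ ∈ H`. [cite: MochizukiFrdII2008, Rmk 2.2.1 p.18] -/
theorem mem_invariantsSubmonoid_ofGalois_iff (f : O) :
    f ∈ Kummer.invariantsSubmonoid O (ofGalois L H hH res res_smul).HA ↔
      ∀ σ ∈ H, resGal L σ • f = f := by
  constructor
  · intro hf σ hσ
    exact hf ⟨resGal L σ, σ, hσ, rfl⟩
  · rintro hf ⟨_, σ, hσ, rfl⟩
    exact hf σ hσ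

end Def22Context

/-! ### The special case `Aut_C(A) ↠ G_A ≅ Gal(L/K)` already divided out -/

namespace Def22Context

variable {K : Type} [Field K] (L : IntermediateField K (AlgebraicClosure K)) [Normal K L]
  [FiniteDimensional K L]
  (H : Subgroup (absoluteGaloisGroup K)) [H.Normal] (hH : IsOpen (H : Set (absoluteGaloisGroup K)))
  (O : Type) [CommMonoid O] [IsCancelMul O] [MulDistribMulAction (L ≃ₐ[K] L) O]

/-- The Galois context with `Aut_C(A)` replaced by its quotient `G_A ≅ Aut_E(A_E) = Gal(L/K)`
(Def. 2.2 (i): "`G_A := Aut_C(A)/Ker(Aut_C(A) → Aut_E(A_E))` … an isomorphism if, for instance,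
`A_D` is Galois"): `Aut_C := Gal(L/K)`, `res := id`. Every construction of Def. 2.2 (ii)–2.3 and
Thm. 2.4 depends on `Aut_C(A)` only through `G_A` and its image in `Aut_E(A_E)`.
[cite: MochizukiFrdII2008, Def 2.2 (i) p.17] -/
noncomputable abbrev ofGaloisQuot : Def22Context :=
  ofGalois L H hH (AutC := L ≃ₐ[K] L) (O := O) (MonoidHom.id _) fun _ _ => rfl

/-- For `ofGaloisQuot`, the claim "`G_A ↪ Aut_E(A_E)` is an isomorphism if `A_D` is Galois"
(`GaloisSurjective`) holds: `res = id`. [cite: MochizukiFrdII2008, Def 2.2 (i) p.17] -/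
theorem galoisSurjective_ofGaloisQuot : (ofGaloisQuot L H hH O).GaloisSurjective := by
  unfold GaloisSurjective
  intro _ τ
  exact ⟨QuotientGroup.mk τ, rfl⟩

end Def22Context

end PadicKummer

end Literature.AlgebraicGeometry.Frobenioids
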